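import Mathlib

/-!
# SoloBlindMembraneExit — first exit from the late left world is through its frontier (solo-blind, s26)

Companion to `SoloBlindMembrane` (p192087).  Abstract core of Note I §I6.4
(`run/shared/lean/ideation/FinalStateConjecture/solo-blind/paper/interior-package-note.md`):
a path that starts INSIDE a closed set `U` with `frontier U ⊆ Λ ∪ F` and is later outside `U`
has a FIRST EXIT parameter `σ₁`; the path is in `U` on `[0, σ₁]` and `γ σ₁ ∈ Λ ∪ F`.  If the
path never meets `Λ` (in the application: it starts LATE, and `Λ` is the compact early bottom of
the late left world), the exit point is on the face `F`; consequently every point of the path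
is either in `U` or comes after a face point — the abstract form of
`J⁺(L_T) ⊆ U′ ∪ J⁺(F′_late)`, from which hypothesis (C) of Theorem B is reduced to the layer
estimate plus the length bound (KL⁺) on `J⁺(F′)`.  No temporality is needed for this direction
(it is needed only for "no re-entry", which is `membrane_no_contact`).

Elementary point-set topology; standard axioms only.
-/

namespace Summit.FinalStateConjecture.FinalStateConjecture.Theorems

open Set Topology

variable {X : Type*} [TopologicalSpace X]

/-- **First exit.**  `U` closed, `frontier U ⊆ Λ ∪ F`, `γ : ℝ → X` continuous with `γ 0 ∈ U`
and `γ b ∉ U` (`0 ≤ b`).  Then there is a first exit parameter `σ₁ ∈ [0, b)`: `γ` is in `U` on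
`[0, σ₁]`, `γ σ₁ ∈ Λ ∪ F` (a frontier point of `U`), and parameters in `(σ₁, b]` arbitrarily
close to `σ₁` are mapped outside `U`. -/
theorem membrane_first_exit_mem
    (U Λ F : Set X) (hU : IsClosed U) (hfr : frontier U ⊆ Λ ∪ F)
    (γ : ℝ → X) (hγ : Continuous γ) {b : ℝ} (hb : 0 ≤ b)
    (h0 : γ 0 ∈ U) (h1 : γ b ∉ U) :
    ∃ σ₁ ∈ Ico (0:ℝ) b, (∀ σ ∈ Icc (0:ℝ) σ₁, γ σ ∈ U) ∧ γ σ₁ ∈ frontier U ∧ γ σ₁ ∈ Λ ∪ F ∧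
      ∀ ε > 0, ∃ s ∈ Icc (0:ℝ) b, σ₁ ≤ s ∧ s < σ₁ + ε ∧ γ s ∉ U := by
  set S : Set ℝ := Icc (0:ℝ) b ∩ γ ⁻¹' Uᶜ with hS
  have hbS : b ∈ S := ⟨⟨hb, le_rfl⟩, h1⟩
  have hSne : S.Nonempty := ⟨b, hbS⟩
  have hSbdd : BddBelow S := ⟨0, fun σ hσ => hσ.1.1⟩
  set σ₁ := sInf S with hσ₁
  have hσ₁0 : 0 ≤ σ₁ := le_csInf hSne fun σ hσ => hσ.1.1
  have hσ₁b : σ₁ ≤ b := csInf_le hSbdd hbS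
  -- before `σ₁` the path is in `U`
  have hbefore : ∀ σ ∈ Ico (0:ℝ) σ₁, γ σ ∈ U := by
    intro σ hσ
    by_contra hσU
    have hσS : σ ∈ S := ⟨⟨hσ.1, le_trans hσ.2.le hσ₁b⟩, hσU⟩
    exact absurd (csInf_le hSbdd hσS) (not_le.mpr hσ.2)
  -- near `σ₁` from above there are parameters of `S`
  have hafter : ∀ ε > 0, ∃ s ∈ Icc (0:ℝ) b, σ₁ ≤ s ∧ s < σ₁ + ε ∧ γ s ∉ U := by
    intro ε hε
    obtain ⟨s, hsS, hslt⟩ := exists_lt_of_csInf_lt hSne (by linarith : sInf S < σ₁ + ε)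
    exact ⟨s, hsS.1, csInf_le hSbdd hsS, hslt, hsS.2⟩
  -- `γ σ₁ ∈ U`
  have hσ₁U : γ σ₁ ∈ U := by
    by_contra hnot
    rcases eq_or_lt_of_le hσ₁0 with h | hpos
    · exact hnot (h ▸ h0)
    · have hopen : γ ⁻¹' Uᶜ ∈ 𝓝 σ₁ := hγ.continuousAt.preimage_mem_nhds (hU.isOpen_compl.mem_nhds hnot)
      have hev : ∀ᶠ σ in 𝓝[<] σ₁, γ σ ∉ U := mem_nhdsWithin_of_mem_nhds hopen
      have hnonneg : ∀ᶠ σ in 𝓝[<] σ₁, (0:ℝ) ≤ σ :=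
        mem_nhdsWithin_of_mem_nhds
          (Filter.mem_of_superset (Ioi_mem_nhds hpos) fun σ hσ => le_of_lt (mem_Ioi.mp hσ))
      have hlt : ∀ᶠ σ in 𝓝[<] σ₁, σ < σ₁ := self_mem_nhdsWithin
      obtain ⟨σ, hσU, hσ0, hσlt⟩ := (hev.and (hnonneg.and hlt)).exists
      exact hσU (hbefore σ ⟨hσ0, hσlt⟩)
  -- `γ σ₁ ∉ interior U`
  have hσ₁int : γ σ₁ ∉ interior U := by
    intro hint
    have hnhds : γ ⁻¹' interior U ∈ 𝓝 σ₁ :=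
      hγ.continuousAt.preimage_mem_nhds (isOpen_interior.mem_nhds hint)
    obtain ⟨ε, hε, hball⟩ := Metric.mem_nhds_iff.mp hnhds
    obtain ⟨s, -, hs1, hs2, hsU⟩ := hafter ε hε
    have hsball : s ∈ Metric.ball σ₁ ε := by
      rw [Metric.mem_ball, Real.dist_eq, abs_lt]
      constructor <;> linarith
    exact hsU (interior_subset (hball hsball))
  have hfrσ : γ σ₁ ∈ frontier U := ⟨subset_closure hσ₁U, hσ₁int⟩
  have hσ₁ne : σ₁ ≠ b := by
    intro h
    exact h1 (h ▸ hσ₁U)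
  refine ⟨σ₁, ⟨hσ₁0, lt_of_le_of_ne hσ₁b hσ₁ne⟩, ?_, hfrσ, hfr hfrσ, hafter⟩
  intro σ hσ
  rcases eq_or_lt_of_le hσ.2 with h | h
  · exact h ▸ hσ₁U
  · exact hbefore σ ⟨hσ.1, h⟩

/-- **In `U`, or after a face point.**  If moreover the path never meets `Λ` on `[0, b]`
(application: it starts late and `Λ` is early), then every parameter `σ ∈ [0, b]` has
`γ σ ∈ U` or is preceded by a parameter `σ₁ ≤ σ` with `γ σ₁ ∈ F` — the abstract form of
`J⁺(L_T) ⊆ U′ ∪ J⁺(F′)`. -/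
theorem membrane_mem_or_after_face
    (U Λ F : Set X) (hU : IsClosed U) (hfr : frontier U ⊆ Λ ∪ F)
    (γ : ℝ → X) (hγ : Continuous γ) {b : ℝ}
    (h0 : γ 0 ∈ U) (hΛ : ∀ σ ∈ Icc (0:ℝ) b, γ σ ∉ Λ) :
    ∀ σ ∈ Icc (0:ℝ) b, γ σ ∈ U ∨ ∃ σ₁ ∈ Icc (0:ℝ) σ, γ σ₁ ∈ F ∧ ∀ τ ∈ Icc (0:ℝ) σ₁, γ τ ∈ U := by
  intro σ hσ
  by_cases hσU : γ σ ∈ U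
  · exact Or.inl hσU
  · right
    obtain ⟨σ₁, hσ₁, hin, -, hΛF, -⟩ :=
      membrane_first_exit_mem U Λ F hU hfr γ hγ hσ.1 h0 hσU
    have hF : γ σ₁ ∈ F :=
      hΛF.resolve_left (hΛ σ₁ ⟨hσ₁.1, le_trans hσ₁.2.le hσ.2⟩)
    exact ⟨σ₁, ⟨hσ₁.1, hσ₁.2.le⟩, hF, hin⟩

end Summit.FinalStateConjecture.FinalStateConjecture.Theorems
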